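import Mathlib
import HarnessLib
import Summits.ResolutionOfSingularities.ResolutionOfSingularities.Theorems.WildQuotientsWildQuotientResolutionS1aReach
import Summits.ResolutionOfSingularities.ResolutionOfSingularities.Theorems.WildQuotientsWildQuotientResolutionS1aFrameWins

/-!
# S1a — `WinningStrategy p` FROM THE DATUM-RELATIVE RULE `KillOrAuxRuleJInfReach p` (the `Theses`-cone wrapper of `…S1aReach`)

[OURS · L1 W4.5c · lead-1 g8 filing plan-1 g12's SIG KA v1 (wrapper part)] — NOT statements of the manuscript; counted 0; AI-level work, weaker than expert
review. Crux stmt-ResolutionOfSingularities-17941, line `s1a-logminvertex` v6, registered stub `stub_winningStrategy`.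

* **`winningStrategy_of_killOrAuxRuleJInfReach`** `: p.Prime → KillOrAuxRuleJInfReach p → FrameWins.WinningStrategy p` — via `wins_of_killOrAuxJInf` with the
  invariant class `P := (initial).Reachable`: THE REGISTERED STUB IS CLOSED MODULO THE DATUM-RELATIVE RESIDUAL (K) `KillHalfReach` ∧ (A) `AuxHalfReach`;
* `winningStrategy_of_halves`; `cyclicQuotientFourfolds_of_door_of_killOrAuxRuleJInfReach`.
-/

set_option linter.dupNamespace false

noncomputable section

open CategoryTheory Limits AlgebraicGeometry TopologicalSpace
open Literature.AlgebraicGeometry.Resolution Literature.AlgebraicGeometry.RelativeSpec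
open Summit.ResolutionOfSingularities.ResolutionOfSingularities.Theorems.WildQuotientResolution.S1
open Summit.ResolutionOfSingularities.ResolutionOfSingularities.Theorems.WildQuotientResolution.S1.NodeAtlas
open Summit.ResolutionOfSingularities.ResolutionOfSingularities.Theorems.WildQuotientResolution.S1.GameFrame

namespace Summit.ResolutionOfSingularities.ResolutionOfSingularities.Theorems.WildQuotientResolution.S1

/-- **THE TERMINATION CRUX REDUCED TO THE DATUM-RELATIVE RULE**: `KillOrAuxRuleJInfReach p → WinningStrategy p` (`p` prime), via
`wins_of_killOrAuxJInf` with the invariant class `P := Reachable (initial)`. [OURS · L1 W4.5c · plan-1 g12] -/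
theorem winningStrategy_of_killOrAuxRuleJInfReach {p : ℕ} (hp : p.Prime) (hrule : KillOrAuxRuleJInfReach p) :
    FrameWins.WinningStrategy p := by
  intro k _ _ _ X' X₁ f q G _ _ ρ hG hfs hfft hfqc hX₁ _ hreg hqfin hqs hqet hq horb hdim hinj g₀ hg₀ _ h₀
  haveI := hfft
  haveI := hfqc
  haveI := hqfin
  have H := hrule k X' X₁ f q G ρ hG hfs hfft hfqc hX₁ hreg hqfin hqs hqet hq horb hdim hinj g₀ hg₀ h₀
  obtain ⟨n₀, hn₀⟩ := GameFrame.GModel.exists_nat_nu1_lt_of_datum f (GameFrame.GModel.initial (p := p) (g₀ := g₀) hq h₀)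
  refine GameFrame.GModel.wins_of_killOrAuxJInf hp hg₀ ((GameFrame.GModel.initial hq h₀).Reachable)
    (fun M hR hB hT => ?_) (GameFrame.GModel.initial hq h₀) GameFrame.GModel.Reachable.refl
    (GameFrame.GModel.hasNoetherianBase_of_datum f _) hn₀
  rcases H M hR hT with ⟨𝒦, d, hprin, hhit, hmoves⟩ | ⟨𝒦, d, haux, hmoves⟩
  · exact Or.inl ⟨𝒦, d, hprin, hhit, fun M' hmv =>
      ⟨GameFrame.GModel.Reachable.move 𝒦 d hR (isAdmissibleCentre_of_isPrincipalCentre hprin) hmv,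
        GameFrame.GModel.hasNoetherianBase_of_datum f M', hmoves M' hmv⟩⟩
  · exact Or.inr ⟨𝒦, d, haux.1, fun M' hmv =>
      ⟨GameFrame.GModel.Reachable.move 𝒦 d hR haux.1 hmv, GameFrame.GModel.hasNoetherianBase_of_datum f M',
        GameFrame.GModel.exists_nat_nu1_lt_of_datum f M', hmoves M' hmv⟩⟩

/-- The halves close the registered stub's conclusion. -/
theorem winningStrategy_of_halves {p : ℕ} (hp : p.Prime) (hK : KillHalfReach p) (hA : AuxHalfReach p) :
    FrameWins.WinningStrategy p :=
  winningStrategy_of_killOrAuxRuleJInfReach hp (killOrAuxRuleJInfReach_of_halves hK hA)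

/-- **Door + datum-relative rule ⇒ the sub-crux `CyclicQuotientFourfolds`.** [OURS · L1 W4.5c] -/
theorem cyclicQuotientFourfolds_of_door_of_killOrAuxRuleJInfReach (hD : FrameWins.DoorStatement)
    (hrule : ∀ p : ℕ, p.Prime → KillOrAuxRuleJInfReach p) :
    Summit.ResolutionOfSingularities.ResolutionOfSingularities.Theses.WildQuotients.CyclicQuotientFourfolds :=
  FrameWins.cyclicQuotientFourfolds_of_door_of_wins hD fun p hp _ => winningStrategy_of_killOrAuxRuleJInfReach hp (hrule p hp)

end Summit.ResolutionOfSingularities.ResolutionOfSingularities.Theorems.WildQuotientResolution.S1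

end
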